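import Summits.QuantumFields.QCD.Theorems.PauliWegnerSeaChiralGluonicCompletionGlobalContinuum

/-!
# Crux idea `anomaly-refutes-every-branch` — first lemmas (crux-ideate round 2, ideator 5)

Crux `stmt-QuantumFields-17498`, `PauliWegnerSea.ChiralGluonicCompletion` (= `WilsonMobilityGap.…`, rfl):
`∀ N_f ∈ {2,3}, (∃ reg, Hyp N_f reg) → QCDOf N_f`.

Wall (α) of the dead line `Sketch` (Lines/Sketch-dead.md §1a) is the stub
`E* : Hyp reg → ∃ φ, ∀ ψ, IsChiralAtZero ((reg.restrict φ).restrict ψ)` — the HEREDITARY pin — certified not derivable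
from the SHAPE of the typed `∃ᶠ` pin (p142184, p144745, p146141) and minimal (p137857, p139008).

The lever recorded here: a CONTRADICTION-TYPE chirality certificate `W reg` (think: the centred anomalous Ward-triple data
of route `AnomalyRigidity`, `LeeYangMassHandover.WardTripleDataCentered reg`, which refutes a uniform lattice gap on the
degenerate ray through the landed germ lemmas `FarMomentsBoundGerm` p132696 / `AnomalyGermVanishes` p126118 and item 17718)
is made of `∀ᶠ k` clauses, hence inherited by every sub-branch, hence yields E* along any branch carrying it
(`hereditaryPin_of_certificate`, proved).  The `∃ᶠ → ∀ᶠ` upgrade that killed every round-1 lever is then relocated from the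
pin's violation family (no finite-intersection property) to ONE real sequence per regularisation — an OFFSET FUNCTION
`M : ℕ → ℝ` (physically the PCAC offset of cutoff `k`) — where it is trivial: level sets of a real sequence are nested
(`levelSet_antitone`) and `Filter.extraction_of_frequently_atTop` selects a branch with `M ∘ φ → 0`
(`exists_branch_tendsto_zero`, proved).  The pin's only job is to LOCATE: with massive cutoffs uniformly gapped
(`MassiveGapped`) and the package forbidding eventually-negative offsets (`EventuallyAboveNeg`), the `∃ᶠ` pin forces `M`
frequently small at every level (`frequently_small_of_pin`, proved).  Composition with the landed
`chiralGluonicCompletion_of_hereditaryPin_globalContinuum` (p139623): `crux_of_offsetStubs` (proved, 0 sorry).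

No skeleton here (crux-ideate stage): the open content is carried by the three typed predicates `IsOffsetFunction`,
`MassiveGapped`, `EventuallyAboveNeg` and by the abstract certificate axioms `IsBranchCertificate`.
-/

noncomputable section

namespace Summit.QuantumFields.QCD.Cruxes.ChiralGluonicCompletion.AnomalyBranch

open MeasureTheory Filter Topology
open Literature.MathematicalPhysics.QuantumFieldTheory Literature.MathematicalPhysics.QuantumLattice
  Literature.Probability.LatticeModels
open Summit.QuantumFields.QCD.Theorems.StronglyChiralSubsequence

variable {Nf : ℕ}

/-! ## §1 Contradiction-type certificates are hereditary, so they pay E* -/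

/-- A **branch certificate**: a predicate on regularisations which (h) passes to every reindexing along a strictly
increasing map and (r) refutes the uniform lattice gap at every rate, i.e. implies `IsChiralAtZero`.
Instance in view: `W reg := LeeYangMassHandover.WardTripleDataCentered reg ∧ (∀ m ∈ (0,1], physical branch) ∧
asymptotic scaling`, for which (r) is `isChiralAtZero_of_wardTripleDataCentered` (Cruxes/RobustYangMillsHandover/Lines/
lee_yang_mass_handover.lean §3, modulo item 17718 `UniformGapFarMoments`(LV) and the LANDED 17719, 16262) and (h) is
bookkeeping (every clause of the Ward data is `∀ δ, ∀ᶠ k, ∀ S ≥ L_k, …`). -/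
structure IsBranchCertificate (W : QCDRegularisation Nf → Prop) : Prop where
  hereditary : ∀ (r : QCDRegularisation Nf) (ψ : ℕ → ℕ) (hψ : StrictMono ψ), W r → W (r.restrict ψ hψ.tendsto_atTop)
  refutes : ∀ r : QCDRegularisation Nf, W r → r.IsChiralAtZero

/-- **E* from a certificate on one branch.**  If `W` is a branch certificate and the branch `reg.restrict φ` carries it,
the pin holds along EVERY further sub-branch — verbatim the dead stub `stub_hereditaryPin`'s conclusion for this `φ`. -/
theorem hereditaryPin_of_certificate {W : QCDRegularisation Nf → Prop} (hW : IsBranchCertificate W)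
    (reg : QCDRegularisation Nf) (φ : ℕ → ℕ) (hφ : StrictMono φ) (h : W (reg.restrict φ hφ.tendsto_atTop)) :
    ∀ (ψ : ℕ → ℕ) (hψ : StrictMono ψ),
      ((reg.restrict φ hφ.tendsto_atTop).restrict ψ hψ.tendsto_atTop).IsChiralAtZero :=
  fun ψ hψ => hW.refutes _ (hW.hereditary _ ψ hψ h)

/-- **Branch selection** for the certificate `W` over the crux's hypothesis: every `Hyp`-witness with a lattice gap at every
positive tuple (C1, proved anyway by every line) has a branch carrying `W`. -/
def BranchSelection (Nf : ℕ) (W : QCDRegularisation Nf → Prop) : Prop :=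
  ∀ reg : QCDRegularisation Nf, Hyp Nf reg →
    (∀ m : Fin Nf → ℝ, (∀ f, 0 < m f) → ∃ Δ > 0, (reg.scheme m 0 0).HasLatticeMassGap Δ) →
      ∃ φ : ℕ → ℕ, ∃ hφ : StrictMono φ, W (reg.restrict φ hφ.tendsto_atTop)

/-- **The line, abstract form**: branch certificates + branch selection replace E*; C1 and C2' as in the landed composition
`chiralGluonicCompletion_of_hereditaryPin_globalContinuum` (p139623). -/
theorem crux_of_branchSelection (W : (Nf : ℕ) → QCDRegularisation Nf → Prop)
    (hW : ∀ Nf : ℕ, Nf = 2 ∨ Nf = 3 → IsBranchCertificate (W Nf))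
    (hsel : ∀ Nf : ℕ, Nf = 2 ∨ Nf = 3 → BranchSelection Nf (W Nf))
    (hC1 : ∀ Nf : ℕ, Nf = 2 ∨ Nf = 3 → ∀ reg : QCDRegularisation Nf, Hyp Nf reg →
      ∀ m : Fin Nf → ℝ, (∀ f, 0 < m f) → ∃ Δ > 0, (reg.scheme m 0 0).HasLatticeMassGap Δ)
    (hC2 : ∀ Nf : ℕ, Nf = 2 ∨ Nf = 3 → ∀ reg : QCDRegularisation Nf, Hyp Nf reg →
      (∀ m : Fin Nf → ℝ, (∀ f, 0 < m f) → ∃ Δ > 0, (reg.scheme m 0 0).HasLatticeMassGap Δ) →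
        ∃ φ : ℕ → ℕ, ∃ hφ : StrictMono φ, ∀ m : Fin Nf → ℝ, (∀ f, 0 < m f) →
          ContinuumBody Nf (reg.restrict φ hφ.tendsto_atTop) m) :
    Summit.QuantumFields.QCD.Theses.PauliWegnerSea.ChiralGluonicCompletion := by
  refine chiralGluonicCompletion_of_hereditaryPin_globalContinuum ?_ hC1 hC2
  intro Nf hNf reg hH
  obtain ⟨φ, hφ, hWφ⟩ := hsel Nf hNf reg hH (hC1 Nf hNf reg hH)
  exact ⟨φ, hφ, hereditaryPin_of_certificate (hW Nf hNf) reg φ hφ hWφ⟩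

/-! ## §2 Selection on a real sequence is trivial (contrast: `pinShape_not_entails_hereditaryPin`, p142184) -/

/-- Level sets of a real sequence are NESTED in the level — the finite-intersection property that the pin's violation
family `V(ε_j, m_j, A_j, B_j, C)` lacks (different masses per rate). [folklore] -/
theorem levelSet_antitone (M : ℕ → ℝ) : Antitone (fun j : ℕ => {k : ℕ | |M k| < 1 / ((j : ℝ) + 1)}) := by
  intro i j hij k hk
  simp only [Set.mem_setOf_eq] at hk ⊢
  have hi : (0 : ℝ) < (i : ℝ) + 1 := by positivity
  have hle : (1 : ℝ) / ((j : ℝ) + 1) ≤ 1 / ((i : ℝ) + 1) :=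
    one_div_le_one_div_of_le hi (by exact_mod_cast Nat.succ_le_succ hij)
  exact lt_of_lt_of_le hk hle

/-- **Frequently small at every level ⇒ a branch along which the sequence tends to `0`.** [folklore] -/
theorem exists_branch_tendsto_zero {M : ℕ → ℝ} (h : ∀ j : ℕ, ∃ᶠ k in atTop, |M k| < 1 / ((j : ℝ) + 1)) :
    ∃ φ : ℕ → ℕ, StrictMono φ ∧ Tendsto (M ∘ φ) atTop (𝓝 0) := by
  obtain ⟨φ, hφ, hφM⟩ := extraction_forall_of_frequently h
  refine ⟨φ, hφ, ?_⟩
  rw [tendsto_zero_iff_abs_tendsto_zero]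
  have h0 : Tendsto (fun _ : ℕ => (0 : ℝ)) atTop (𝓝 0) := tendsto_const_nhds
  have h1 : Tendsto (fun j : ℕ => 1 / ((j : ℝ) + 1)) atTop (𝓝 0) := tendsto_one_div_add_atTop_nhds_zero_nat
  have hle : ∀ j : ℕ, |(M ∘ φ) j| ≤ 1 / ((j : ℝ) + 1) := fun j => le_of_lt (hφM j)
  exact tendsto_of_tendsto_of_tendsto_of_le_of_le h0 h1 (fun j => abs_nonneg _) hle

/-! ## §3 The pin LOCATES an honest branch: three typed predicates about ONE offset function -/

/-- **`M` is an offset function for `reg` relative to the certificate `W`**: along every branch on which `M` tends to `0`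
some further branch carries `W`.  Physics: `M k` = the PCAC offset of cutoff `k` (the renormalised mass at which the
lattice axial Ward identity's PCAC mass extrapolates to zero, Montvay–Münster §5.3.2 (5.171)–(5.177)); along a branch with
`M → 0` the limiting subtracted Ward identity reads `(p+q)·Γ_m = κ m Γ^P_m + c ε(p,q) + o(|k|²)` with the HONEST mass
`κ m`, and centred Ward-triple data exist on a convergent sub-branch (the `AnomalousWardTriple` (b)-burden of item 17716,
shared with `lee_yang_mass_handover.stub_wardTripleAtPin`). -/
def IsOffsetFunction (W : QCDRegularisation Nf → Prop) (reg : QCDRegularisation Nf) (M : ℕ → ℝ) : Prop :=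
  ∀ (φ : ℕ → ℕ) (hφ : StrictMono φ), Tendsto (M ∘ φ) atTop (𝓝 0) →
    ∃ ψ : ℕ → ℕ, ∃ hψ : StrictMono ψ, W ((reg.restrict φ hφ.tendsto_atTop).restrict ψ hψ.tendsto_atTop)

/-- **Massive cutoffs are uniformly gapped**: for every `μ > 0` ONE rate `Δ(μ) > 0` such that for every positive tuple and
every pair of observables the gap inequality at rate `Δ(μ)` holds eventually on the cutoffs whose offset is at least `μ`,
on all tori `S ≥ L_k`.  Physics: at label `m` the physical quark mass is `m + M k ≥ μ`, and QCD with all quark masses `≥ μ`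
is gapped at a rate depending on `μ` only (C1 in its honest, physical-mass-uniform form; cf. item 8922
`GradientFlowSpecies.MassiveLatticeGap`). -/
def MassiveGapped (reg : QCDRegularisation Nf) (M : ℕ → ℝ) : Prop :=
  ∀ μ > (0 : ℝ), ∃ Δ > (0 : ℝ), ∀ m : Fin Nf → ℝ, (∀ f, 0 < m f) →
    ∀ (R R' : ℕ) (A : QCDLatticeObservable Nf R) (B : QCDLatticeObservable Nf R'), ∃ C : ℝ,
      ∀ᶠ k in atTop, μ ≤ M k → ∀ S : ℕ, reg.L k ≤ S → ∀ n : ℕ, n ≤ S →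
        ‖qcdLatticeConnectedCorr (reg.β k) (2 * S + 1) (fun fl => (reg.scheme m 0 0).mq fl k) A B n‖ ≤
          C * Real.exp (-(Δ * (reg.a k * n)))

/-- **The package forbids eventually-negative offsets**: for every `μ > 0`, eventually `M k > −μ`.  Physics: clause (ii)
(phase-quenched localisation at a physical rate at EVERY positive label, eventually) fails at and beyond the chiral/Aoki
line (Golterman–Shamir: the mobility edge of `γ₅ D_W` reaches zero there), so the given `m_crit(k)` cannot sit a fixed
physical distance ABOVE the honest critical line infinitely often. -/
def EventuallyAboveNeg (M : ℕ → ℝ) : Prop :=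
  ∀ μ > (0 : ℝ), ∀ᶠ k in atTop, -μ < M k

/-- **The pin locates.**  If massive cutoffs are uniformly gapped and offsets are eventually above every negative level,
the typed `∃ᶠ` pin forces the offset function to be frequently small at every level. -/
theorem frequently_small_of_pin (reg : QCDRegularisation Nf) (M : ℕ → ℝ) (hpin : reg.IsChiralAtZero)
    (hmass : MassiveGapped reg M) (hneg : EventuallyAboveNeg M) :
    ∀ j : ℕ, ∃ᶠ k in atTop, |M k| < 1 / ((j : ℝ) + 1) := by
  intro j
  set μ : ℝ := 1 / ((j : ℝ) + 1) with hμ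
  have hμpos : 0 < μ := by positivity
  by_contra hcon
  rw [Filter.not_frequently] at hcon
  -- eventually `|M k| ≥ μ` and `M k > -μ`, hence eventually `μ ≤ M k`
  have hlarge : ∀ᶠ k in atTop, μ ≤ M k := by
    filter_upwards [hcon, hneg μ hμpos] with k hk hk'
    rw [not_lt] at hk
    by_contra hlt
    rw [not_le] at hlt
    have : |M k| < μ := abs_lt.2 ⟨hk', hlt⟩
    exact absurd hk (not_le.2 this)
  -- so the uniform gap `Δ(μ)` holds at EVERY positive tuple: contradiction with the pin at rate `Δ(μ)`
  obtain ⟨Δ, hΔ, hgap⟩ := hmass μ hμpos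
  obtain ⟨m, hm, hng⟩ := hpin Δ hΔ
  apply hng
  intro R R' A B
  obtain ⟨C, hC⟩ := hgap m hm R R' A B
  refine ⟨C, ?_⟩
  filter_upwards [hC, hlarge] with k hk hk' S hS n hn
  exact hk hk' S hS n hn

/-- **Offset stubs ⇒ branch selection.**  An offset function that is massive-gapped and eventually above every negative
level gives, for a `Hyp`-witness (whose pin is all that is used), a branch carrying the certificate. -/
theorem branchSelection_of_offset (W : QCDRegularisation Nf → Prop)
    (hoff : ∀ reg : QCDRegularisation Nf, Hyp Nf reg →
      (∀ m : Fin Nf → ℝ, (∀ f, 0 < m f) → ∃ Δ > 0, (reg.scheme m 0 0).HasLatticeMassGap Δ) →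
        ∃ M : ℕ → ℝ, IsOffsetFunction W reg M ∧ MassiveGapped reg M ∧ EventuallyAboveNeg M) :
    BranchSelection Nf W := by
  intro reg hH hC1
  obtain ⟨M, hO, hmass, hneg⟩ := hoff reg hH hC1
  obtain ⟨φ, hφ, hφ0⟩ := exists_branch_tendsto_zero (frequently_small_of_pin reg M hH.2.1 hmass hneg)
  obtain ⟨ψ, hψ, hW⟩ := hO φ hφ hφ0
  refine ⟨φ ∘ ψ, hφ.comp hψ, ?_⟩
  rw [← restrict_restrict reg φ hφ.tendsto_atTop ψ hψ.tendsto_atTop]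
  exact hW

/-- **The line, offset form** (0 sorry): for `N_f ∈ {2,3}`, branch certificates `W` (hereditary + refuting uniform gaps),
offset functions for every `Hyp`-witness (`IsOffsetFunction ∧ MassiveGapped ∧ EventuallyAboveNeg`), C1 and C2' prove the crux.
The registered stubs of a crux-plan would be: `stub_certificate` ((h)+(r) for the Ward-triple instance: bookkeeping + item
17718 + landed 17719/16262), `stub_offset` (the three predicates for the PCAC offset: the bet), `stub_latticeGap` (C1),
`stub_continuum` (C2'). -/
theorem crux_of_offsetStubs (W : (Nf : ℕ) → QCDRegularisation Nf → Prop)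
    (hW : ∀ Nf : ℕ, Nf = 2 ∨ Nf = 3 → IsBranchCertificate (W Nf))
    (hoff : ∀ Nf : ℕ, Nf = 2 ∨ Nf = 3 → ∀ reg : QCDRegularisation Nf, Hyp Nf reg →
      (∀ m : Fin Nf → ℝ, (∀ f, 0 < m f) → ∃ Δ > 0, (reg.scheme m 0 0).HasLatticeMassGap Δ) →
        ∃ M : ℕ → ℝ, IsOffsetFunction (W Nf) reg M ∧ MassiveGapped reg M ∧ EventuallyAboveNeg M)
    (hC1 : ∀ Nf : ℕ, Nf = 2 ∨ Nf = 3 → ∀ reg : QCDRegularisation Nf, Hyp Nf reg →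
      ∀ m : Fin Nf → ℝ, (∀ f, 0 < m f) → ∃ Δ > 0, (reg.scheme m 0 0).HasLatticeMassGap Δ)
    (hC2 : ∀ Nf : ℕ, Nf = 2 ∨ Nf = 3 → ∀ reg : QCDRegularisation Nf, Hyp Nf reg →
      (∀ m : Fin Nf → ℝ, (∀ f, 0 < m f) → ∃ Δ > 0, (reg.scheme m 0 0).HasLatticeMassGap Δ) →
        ∃ φ : ℕ → ℕ, ∃ hφ : StrictMono φ, ∀ m : Fin Nf → ℝ, (∀ f, 0 < m f) →
          ContinuumBody Nf (reg.restrict φ hφ.tendsto_atTop) m) :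
    Summit.QuantumFields.QCD.Theses.PauliWegnerSea.ChiralGluonicCompletion :=
  crux_of_branchSelection W hW (fun Nf hNf => branchSelection_of_offset (W Nf) (hoff Nf hNf)) hC1 hC2

/-! ## §4 Sanity: the three offset predicates are jointly inhabited in kind (honest regularisation, `M ≡ 0`) -/

/-- For the identically-zero offset function, `EventuallyAboveNeg` holds. [folklore] -/
theorem eventuallyAboveNeg_zero : EventuallyAboveNeg (fun _ : ℕ => (0 : ℝ)) :=
  fun μ hμ => Eventually.of_forall fun _ => by linarith

/-- For the identically-zero offset function, `MassiveGapped` is vacuous (no cutoff is massive). [folklore] -/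
theorem massiveGapped_zero (reg : QCDRegularisation Nf) : MassiveGapped reg (fun _ : ℕ => (0 : ℝ)) := by
  intro μ hμ
  refine ⟨1, one_pos, fun m _ R R' A B => ⟨0, Eventually.of_forall fun k hk => ?_⟩⟩
  exact absurd hk (not_le.2 hμ)

/-- For the identically-zero offset function, `IsOffsetFunction W reg 0` says exactly: EVERY branch of `reg` has a
sub-branch carrying `W` — the honest-regularisation case, where the Ward data are expected along the whole sequence. -/
theorem isOffsetFunction_zero_iff (W : QCDRegularisation Nf → Prop) (reg : QCDRegularisation Nf) :
    IsOffsetFunction W reg (fun _ => 0) ↔ ∀ (φ : ℕ → ℕ) (hφ : StrictMono φ),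
      ∃ ψ : ℕ → ℕ, ∃ hψ : StrictMono ψ, W ((reg.restrict φ hφ.tendsto_atTop).restrict ψ hψ.tendsto_atTop) := by
  constructor
  · intro h φ hφ
    exact h φ hφ tendsto_const_nhds
  · intro h φ hφ _
    exact h φ hφ

end Summit.QuantumFields.QCD.Cruxes.ChiralGluonicCompletion.AnomalyBranch

end
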